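import Summits.BirchSwinnertonDyer.Rank1Residual.X1.GeneratorBound
import Summits.BirchSwinnertonDyer.Rank1Residual.X1.LambdaSqueezeAlgebra
import Literature.NumberTheory.EllipticCurves.IwasawaAlgebraMuAdditiveProofs
import Literature.NumberTheory.EllipticCurves.IwasawaAlgebraProofs
import Summits.BirchSwinnertonDyer.Rank1Residual.Additive.CongruentPartnerBudgetSchemaHolds
import Mathlib.LinearAlgebra.TensorProduct.Quotient
import Mathlib.LinearAlgebra.TensorProduct.RightExactness
import HarnessLib

/-!
# GREENBERG'S INEQUALITY in the kernel: `#(X/𝔪X) ≤ p^{λ(X) + μ(X)}` for a finitely generated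
# torsion `Λ`-module without nonzero finite submodules (cell `b2b-bsdres`, unit
# `b2b-bsdres-eisenstein-p1`, gen 17; X1R0-GAPMAP §26)

HONEST FRAMING (run/shared/lean/b2b/bsd-rank1-residual/, verbatim in every file): the goal of the
cell is to DELETE the COMBINATION-SHAPED residual classes of the Birch–Swinnerton-Dyer formula for
ALL analytic-rank `≤ 1` elliptic curves over `ℚ` — "full BSD formula for every rank `≤ 1` curve in
class `C`" assembled STRICTLY from published theorems — so that the rank-`≤ 1` remainder becomes
exactly the CONSTRUCTION-SHAPED classes, which are TYPED (missing-input `Prop`s), NOT attempted.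
This is not "finishing BSD". Sub-cell `b2b-bsdres-eisenstein-p1` (CLASS-OWNERS row "X1 (r = 0)"):
research route; NO CLAIM BEYOND STATED CLASSES; nothing here changes a label; nothing is booked.
THEOREMS ONLY — no definition, no named fact, no typed input introduced; pure `Λ`-module algebra,
nothing about any curve.

## What and why

Route T's census (X1R0-GAPMAP §14.1) and route M at `μ ≥ 1` members use, besides LEMMA M₀
(`X1/GeneratorBound.lean`: `#(X/𝔪X) ≤ p^{v_p(f(0))}`), GREENBERG'S INEQUALITY
`dim_{𝔽_p} X/𝔪X ≤ λ(X) + μ(X)` — so far only through the TYPED input `AlgebraicLambdaGE`. This file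
proves it for every finitely generated torsion `Λ = ℤ_p⟦T⟧`-module `X` WITHOUT nonzero finite
`Λ`-submodules (`natCard_quotient_maximalIdeal_le_pow_lambda_add_mu`), by the dévissage
`0 → X_t → X → X_f → 0` with `X_t = X[p^∞]` (the `p`-power torsion `Λ`-submodule,
`Submodule.torsion' Λ X (powers p)`) and `X_f = X/X_t`:

* §1 `X_f` is `p`-torsion-free, hence has no nonzero finite `Λ`-submodule (a finite `Λ`-module is
  `p`-power torsion elementwise, tree `exists_C_p_pow_smul_eq_zero_of_isPseudoNull` /
  `isPseudoNull_of_finite`), and `μ(X_f) = 0` (`X` is killed by some `s = p^a·s'` with `p ∤ s'`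
  (`MuLambda.eq_C_pow_mu_mul_pfree`), and `s'` kills `X_f`, so `(X_f)_{(p)} = 0`); `X_t` has no
  nonzero finite submodule (it sits in `X`) and `λ(X_t) = 0` (`ℚ_p ⊗ X_t = 0`).
* §2 additivity: `μ(X) = μ(X_t) + μ(X_f) = μ(X_t)` (tree `muInvariant_add_of_shortExact_holds`) and
  `λ(X) = λ(X_t) + λ(X_f) = λ(X_f)` (tree `charIdeal_mul_of_shortExact_holds` + `λ` of generators,
  `ParitySqueeze.lam_generator_eq_lambdaInvariant`, `MuLambda.lam_mul`).
* §3 the two bounds: `#(X_f/𝔪X_f) ≤ p^{λ(X_f)}` (`X_f` is `ℤ_p`-free of rank `λ`: tree (L1)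
  `Additive.card_quotient_eq_pow_lambdaInvariant_holds`, as in `X1/GeneratorCountLambda.lean`) and
  `#(X_t/𝔪X_t) ≤ #(X_t/TX_t) = p^{μ(X_t)}` (LEMMA M₀'s Euler characteristic
  `GeneratorBound.natCard_coinvariants_eq` at a generator `f_t` of `char X_t`: `λ(f_t) = 0`, so
  `v_p(f_t(0)) = μ(f_t) = μ(X_t)`, `ParitySqueeze.valuation_constantCoeff_of_lam_eq_zero`,
  `MuPart.mu_generator_eq_muInvariant`).
* §4 right exactness of `Λ/𝔪 ⊗ −` (`lTensor_exact`, `TensorProduct.quotTensorEquivQuotSMul`):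
  `#(X/𝔪X) ≤ #(X_t/𝔪X_t) · #(X_f/𝔪X_f) ≤ p^{μ(X)} · p^{λ(X)}`.

The necessity of "no finite submodule": `X = Λ/𝔪` has `λ = μ = 0` but `dim X/𝔪X = 1`. Consumers
(next file): `AlgebraicLambdaMem W p {d | B ≤ d + m}` from `GeneratorCountGE W p B` and
`AnalyticMuLE W p m` at ANY member of a leaf class (census rule "`deg D ≥ B_j − μ_j`").

References: [GreenbergLNM1716] §1 p. 60, §4 Lemma 4.2, Prop. 4.14/4.15, p. 137, §5 (Remark after
Cor. 5.5: `λ`, `μ` additive); [Washington1997] §13.2 (Thm. 13.12, Prop. 13.8, after Thm. 13.12);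
X1R0-GAPMAP §14.1, §21–§26.
-/

noncomputable section

open scoped Classical TensorProduct

open PowerSeries Literature.NumberTheory.EllipticCurves
  Literature.NumberTheory.EllipticCurves.IwasawaAlgebra IsLocalRing
  Summit.BirchSwinnertonDyer.Rank1Residual.X1.MuLambda
  Summit.BirchSwinnertonDyer.Rank1Residual.X1.MuPart
  Summit.BirchSwinnertonDyer.Rank1Residual.X1.ParitySqueeze

set_option autoImplicit false

universe u

namespace Summit.BirchSwinnertonDyer.Rank1Residual.X1.GeneratorBoundMu

variable {p : ℕ} [hp : Fact p.Prime] (M : Type u) [AddCommGroup M] [Module (IwasawaAlgebra p) M]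

/-! ## §1. The `p`-power torsion submodule `X_t = X[p^∞]` and the quotient `X_f = X/X_t` -/

/-- Membership in `X_t = torsion' Λ X (powers p)`: `x ∈ X_t ↔ pⁿ·x = 0` for some `n`. [folklore] -/
theorem mem_torsionP_iff (x : M) :
    x ∈ Submodule.torsion' (IwasawaAlgebra p) M
        (Submonoid.powers (C (p : ℤ_[p]) : IwasawaAlgebra p)) ↔
      ∃ n : ℕ, (C (p : ℤ_[p]) : IwasawaAlgebra p) ^ n • x = 0 := by
  rw [Submodule.mem_torsion'_iff]
  constructor
  · rintro ⟨⟨a, n, rfl⟩, h⟩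
    exact ⟨n, h⟩
  · rintro ⟨n, h⟩
    exact ⟨⟨_, n, rfl⟩, h⟩

/-- **`X_f = X/X_t` is `p`-power-torsion-free**: if `pⁿ · x̄ = 0` in `X/X_t` then `x ∈ X_t`, i.e.
`x̄ = 0`. [folklore] -/
theorem mem_torsionP_of_C_pow_smul_mkQ_eq_zero {x : M} {n : ℕ}
    (h : (C (p : ℤ_[p]) : IwasawaAlgebra p) ^ n •
      (Submodule.torsion' (IwasawaAlgebra p) M
        (Submonoid.powers (C (p : ℤ_[p]) : IwasawaAlgebra p))).mkQ x = 0) :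
    x ∈ Submodule.torsion' (IwasawaAlgebra p) M
        (Submonoid.powers (C (p : ℤ_[p]) : IwasawaAlgebra p)) := by
  rw [← map_smul, Submodule.mkQ_apply, Submodule.Quotient.mk_eq_zero, mem_torsionP_iff] at h
  obtain ⟨m, hm⟩ := h
  rw [← mul_smul, ← pow_add] at hm
  exact (mem_torsionP_iff M x).mpr ⟨m + n, hm⟩

/-- **`X_f = X/X_t` has no nonzero finite `Λ`-submodule** (for ANY `Λ`-module `X`): a finite
`Λ`-module is pseudo-null, hence `p`-power torsion elementwise (tree
`exists_C_p_pow_smul_eq_zero_of_isPseudoNull`), and `X_f` is `p`-power-torsion-free.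
[cite: Washington1997, §13.2 (pseudo-null = finite)] -/
theorem quotient_torsionP_finite_eq_bot
    (N : Submodule (IwasawaAlgebra p) (M ⧸ Submodule.torsion' (IwasawaAlgebra p) M
        (Submonoid.powers (C (p : ℤ_[p]) : IwasawaAlgebra p))))
    (hN : Finite N) : N = ⊥ := by
  rw [eq_bot_iff]
  intro y hy
  haveI : Finite N := hN
  have hPN : Module.IsPseudoNull (IwasawaAlgebra p) N := isPseudoNull_of_finite p N
  obtain ⟨n, hn⟩ := exists_C_p_pow_smul_eq_zero_of_isPseudoNull p hPN ⟨y, hy⟩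
  have hn' : (C (p : ℤ_[p]) : IwasawaAlgebra p) ^ n • y = 0 := by
    simpa using congrArg Subtype.val hn
  obtain ⟨x, rfl⟩ := Submodule.mkQ_surjective _ y
  rw [Submodule.mem_bot, Submodule.mkQ_apply, Submodule.Quotient.mk_eq_zero]
  exact mem_torsionP_of_C_pow_smul_mkQ_eq_zero M hn'

/-- **`X_t` has no nonzero finite `Λ`-submodule when `X` has none** (it is a submodule of `X`).
[folklore] -/
theorem torsionP_finite_eq_bot (hnf : ∀ N : Submodule (IwasawaAlgebra p) M, Finite N → N = ⊥)
    (N : Submodule (IwasawaAlgebra p) (Submodule.torsion' (IwasawaAlgebra p) M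
        (Submonoid.powers (C (p : ℤ_[p]) : IwasawaAlgebra p))))
    (hN : Finite N) : N = ⊥ := by
  haveI : Finite N := hN
  have hfin : Finite (N.map (Submodule.torsion' (IwasawaAlgebra p) M
      (Submonoid.powers (C (p : ℤ_[p]) : IwasawaAlgebra p))).subtype) :=
    Finite.of_surjective (fun y : N ↦ (⟨_, Submodule.mem_map_of_mem y.2⟩ : N.map _))
      fun ⟨z, hz⟩ ↦ by
        obtain ⟨y, hy, rfl⟩ := Submodule.mem_map.mp hz
        exact ⟨⟨y, hy⟩, rfl⟩
  have h0 := hnf _ hfin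
  refine Submodule.map_injective_of_injective (Submodule.injective_subtype _) ?_
  rw [h0, Submodule.map_bot]

/-- **`μ(X_f) = 0`** for `X` finitely generated torsion: `X` is killed by a nonzero-divisor
`s = p^a · s'` with `p ∤ s'` (`eq_C_pow_mu_mul_pfree`), and `s'` kills `X_f = X/X[p^∞]`; as
`s' ∉ (p)` the localisation of `X_f` at `(p)` vanishes. [cite: Washington1997, §13.2] -/
theorem muInvariant_quotient_torsionP_eq_zero [Module.Finite (IwasawaAlgebra p) M]
    (hM : Module.IsTorsion (IwasawaAlgebra p) M) :
    muInvariant p (M ⧸ Submodule.torsion' (IwasawaAlgebra p) M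
        (Submonoid.powers (C (p : ℤ_[p]) : IwasawaAlgebra p))) = 0 := by
  set Xt := Submodule.torsion' (IwasawaAlgebra p) M
    (Submonoid.powers (C (p : ℤ_[p]) : IwasawaAlgebra p)) with hXt
  obtain ⟨s, hs, hs0⟩ := Submodule.annihilator_top_inter_nonZeroDivisors hM
  have hsne : s ≠ 0 := nonZeroDivisors.ne_zero hs0
  -- `s = p^{μ(s)} · s'` with `p ∤ s'`
  have hfac := eq_C_pow_mu_mul_pfree s
  have hs' : pfree s ∉ augIdealP p := by
    intro h
    rw [augIdealP, Ideal.mem_span_singleton, ← red_eq_zero_iff] at h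
    exact red_pfree_ne_zero hsne h
  -- `s'` kills `X_f`
  have htor : Module.IsTorsionBy (IwasawaAlgebra p) (M ⧸ Xt) (pfree s) := by
    intro y
    obtain ⟨x, rfl⟩ := Submodule.mkQ_surjective Xt y
    rw [← map_smul, Submodule.mkQ_apply, Submodule.Quotient.mk_eq_zero, hXt, mem_torsionP_iff]
    refine ⟨mu s, ?_⟩
    rw [← mul_smul, ← C_pow_eq, ← hfac]
    exact Submodule.mem_annihilator.mp hs x Submodule.mem_top
  let 𝔭 : PrimeSpectrum (IwasawaAlgebra p) := ⟨augIdealP p, isPrime_augIdealP_holds p⟩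
  rw [muInvariant_eq_toNat_lengthAt p (M ⧸ Xt) 𝔭 rfl,
    Module.lengthAt_eq_zero_of_isTorsionBy htor 𝔭 hs']
  simp

/-- **`λ(X_t) = 0`**: `ℚ_p ⊗_{ℤ_p} X_t = 0`, every element of `X_t` being killed by a power of `p`,
which is invertible in `ℚ_p`. [folklore] -/
theorem lambdaInvariant_torsionP_eq_zero :
    lambdaInvariant p (Submodule.torsion' (IwasawaAlgebra p) M
        (Submonoid.powers (C (p : ℤ_[p]) : IwasawaAlgebra p))) = 0 := by
  set Xt := Submodule.torsion' (IwasawaAlgebra p) M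
    (Submonoid.powers (C (p : ℤ_[p]) : IwasawaAlgebra p)) with hXt
  unfold lambdaInvariant
  haveI : Subsingleton (ℚ_[p] ⊗[ℤ_[p]] RestrictScalars ℤ_[p] (IwasawaAlgebra p) Xt) := by
    refine subsingleton_of_forall_eq 0 fun z ↦ ?_
    induction z using TensorProduct.induction_on with
    | zero => rfl
    | tmul q x =>
      -- `x` is killed by `p^n`
      obtain ⟨n, hn⟩ := (mem_torsionP_iff M x.1).mp x.2
      have hx : ((p : ℤ_[p]) ^ n) • x = 0 := by
        change (algebraMap ℤ_[p] (IwasawaAlgebra p) ((p : ℤ_[p]) ^ n)) • (show Xt from x) =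
          (0 : Xt)
        rw [← PowerSeries.C_eq_algebraMap, C_pow_eq]
        refine Subtype.ext ?_
        rw [Submodule.coe_smul, Submodule.coe_zero]
        exact hn
      have hc0 : (((p : ℤ_[p]) ^ n : ℤ_[p]) : ℚ_[p]) ≠ 0 := by
        rw [PadicInt.coe_pow, PadicInt.coe_natCast]
        exact pow_ne_zero _ (Nat.cast_ne_zero.mpr hp.out.ne_zero)
      have hq : q = ((p : ℤ_[p]) ^ n) • ((((p : ℤ_[p]) ^ n : ℤ_[p]) : ℚ_[p])⁻¹ * q) := by
        rw [Algebra.smul_def, ← mul_assoc]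
        change q = (((p : ℤ_[p]) ^ n : ℤ_[p]) : ℚ_[p]) * ((((p : ℤ_[p]) ^ n : ℤ_[p]) : ℚ_[p]))⁻¹ * q
        rw [mul_inv_cancel₀ hc0, one_mul]
      rw [hq, TensorProduct.smul_tmul, hx, TensorProduct.tmul_zero]
    | add a b ha hb => rw [ha, hb, add_zero]
  exact Module.finrank_zero_of_subsingleton

/-! ## §2. Additivity: `μ(X) = μ(X_t)` and `λ(X) = λ(X_f)` -/

/-- A finitely generated torsion `Λ`-module has a NONZERO characteristic power series generating
`char`: `char(N) = (g)`, `g = p^{Σμᵢ}·∏ fⱼ^{nⱼ} ≠ 0` (structure theorem, tree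
`exists_isPseudoIsomorphism_elementary_holds` + `charIdeal_eq_span_holds`). [cite: Washington1997, Thm. 13.12 and §13.2] -/
theorem exists_charGenerator_ne_zero (N : Type u) [AddCommGroup N] [Module (IwasawaAlgebra p) N]
    [Module.Finite (IwasawaAlgebra p) N] (hN : Module.IsTorsion (IwasawaAlgebra p) N) :
    ∃ g : IwasawaAlgebra p, g ≠ 0 ∧
      Module.charIdeal (IwasawaAlgebra p) N = Ideal.span {g} := by
  obtain ⟨μs, fs, -, hfs, hψ⟩ := exists_isPseudoIsomorphism_elementary_holds p N hN
  have hfs' : ∀ f ∈ fs, f.1.IsDistinguishedAt (IsLocalRing.maximalIdeal ℤ_[p]) :=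
    fun f hf ↦ (hfs f hf).1
  refine ⟨charElement p μs fs, ?_, charIdeal_eq_span_holds p N hfs' hψ⟩
  rw [charElement]
  exact mul_ne_zero (C_pow_ne_zero _) (prod_map_pow_ne_zero hfs')

/-- **`μ(X_t) = μ(X)`** for `X` finitely generated torsion: `μ` is additive on
`0 → X_t → X → X_f → 0` (tree `muInvariant_add_of_shortExact_holds`) and `μ(X_f) = 0` (§1).
[cite: Washington1997, §13.2] [cite: GreenbergLNM1716, §5 (Remark after Cor. 5.5)] -/
theorem muInvariant_torsionP_eq [Module.Finite (IwasawaAlgebra p) M]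
    (hM : Module.IsTorsion (IwasawaAlgebra p) M) :
    muInvariant p (Submodule.torsion' (IwasawaAlgebra p) M
        (Submonoid.powers (C (p : ℤ_[p]) : IwasawaAlgebra p))) = muInvariant p M := by
  have h := muInvariant_add_of_shortExact_holds p M hM
    (Submodule.torsion' (IwasawaAlgebra p) M
      (Submonoid.powers (C (p : ℤ_[p]) : IwasawaAlgebra p))).subtype
    (Submodule.torsion' (IwasawaAlgebra p) M
      (Submonoid.powers (C (p : ℤ_[p]) : IwasawaAlgebra p))).mkQ
    (Submodule.injective_subtype _) (Submodule.mkQ_surjective _) (LinearMap.exact_subtype_mkQ _)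
  rw [muInvariant_quotient_torsionP_eq_zero M hM, add_zero] at h
  exact h.symm

/-- **`λ(X_f) = λ(X)`** for `X` finitely generated torsion: `char X = char X_t · char X_f` (tree
`charIdeal_mul_of_shortExact_holds`), `λ` of a generator is the `λ`-invariant
(`ParitySqueeze.lam_generator_eq_lambdaInvariant`), `λ` is additive on products (`MuLambda.lam_mul`)
and `λ(X_t) = 0` (§1). [cite: Washington1997, §13.2] [cite: GreenbergLNM1716, §5 (Remark after Cor. 5.5)] -/
theorem lambdaInvariant_quotient_torsionP_eq [Module.Finite (IwasawaAlgebra p) M]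
    (hM : Module.IsTorsion (IwasawaAlgebra p) M) :
    lambdaInvariant p (M ⧸ Submodule.torsion' (IwasawaAlgebra p) M
        (Submonoid.powers (C (p : ℤ_[p]) : IwasawaAlgebra p))) = lambdaInvariant p M := by
  haveI : IsNoetherian (IwasawaAlgebra p) M := isNoetherian_of_isNoetherianRing_of_finite _ M
  set Xt := Submodule.torsion' (IwasawaAlgebra p) M
    (Submonoid.powers (C (p : ℤ_[p]) : IwasawaAlgebra p)) with hXt
  haveI : Module.Finite (IwasawaAlgebra p) Xt :=
    Module.Finite.of_injective Xt.subtype (Submodule.injective_subtype _)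
  have hTt : Module.IsTorsion (IwasawaAlgebra p) Xt :=
    Literature.NumberTheory.EllipticCurves.isTorsion_of_injective Xt.subtype
      (Submodule.injective_subtype _) hM
  have hTf : Module.IsTorsion (IwasawaAlgebra p) (M ⧸ Xt) :=
    Literature.NumberTheory.EllipticCurves.isTorsion_of_surjective Xt.mkQ
      (Submodule.mkQ_surjective _) hM
  obtain ⟨gt, hgt0, hchart⟩ := exists_charGenerator_ne_zero Xt hTt
  obtain ⟨gf, hgf0, hcharf⟩ := exists_charGenerator_ne_zero (M ⧸ Xt) hTf
  have hmul := charIdeal_mul_of_shortExact_holds p M hM Xt.subtype Xt.mkQ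
    (Submodule.injective_subtype _) (Submodule.mkQ_surjective _) (LinearMap.exact_subtype_mkQ _)
  rw [hchart, hcharf, Ideal.span_singleton_mul_span_singleton] at hmul
  have h1 := lam_generator_eq_lambdaInvariant M hM (mul_ne_zero hgt0 hgf0) hmul
  have h2 := lam_generator_eq_lambdaInvariant Xt hTt hgt0 hchart
  have h3 := lam_generator_eq_lambdaInvariant (M ⧸ Xt) hTf hgf0 hcharf
  rw [lam_mul hgt0 hgf0, h2, h3, hXt, lambdaInvariant_torsionP_eq_zero M, zero_add] at h1
  exact h1

/-! ## §3. The two bounds: `#(X_t/𝔪X_t) ≤ p^{μ(X)}` and `#(X_f/𝔪X_f) ≤ p^{λ(X)}` -/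

/-- **`#(X_t/𝔪X_t) ≤ p^{μ(X)}`** (and `X_t/𝔪X_t` is finite) for `X` finitely generated torsion
without nonzero finite submodules: LEMMA M₀ (`GeneratorBound.natCard_quotient_maximalIdeal_le`) for
`X_t` at a generator `f_t` of `char X_t` — `λ(f_t) = λ(X_t) = 0`, so `f_t(0) ≠ 0` and
`v_p(f_t(0)) = μ(f_t) = μ(X_t) = μ(X)` (`ParitySqueeze.valuation_constantCoeff_of_lam_eq_zero`,
`MuPart.mu_generator_eq_muInvariant`, §2). [cite: GreenbergLNM1716, §4 Lemma 4.2] [cite: Washington1997, §13.2] -/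
theorem natCard_torsionP_quotient_maximalIdeal_le [Module.Finite (IwasawaAlgebra p) M]
    (hM : Module.IsTorsion (IwasawaAlgebra p) M)
    (hnf : ∀ N : Submodule (IwasawaAlgebra p) M, Finite N → N = ⊥) :
    Finite (Submodule.torsion' (IwasawaAlgebra p) M
        (Submonoid.powers (C (p : ℤ_[p]) : IwasawaAlgebra p)) ⧸
      maximalIdeal (IwasawaAlgebra p) • (⊤ : Submodule (IwasawaAlgebra p)
        (Submodule.torsion' (IwasawaAlgebra p) M
          (Submonoid.powers (C (p : ℤ_[p]) : IwasawaAlgebra p))))) ∧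
    Nat.card (Submodule.torsion' (IwasawaAlgebra p) M
        (Submonoid.powers (C (p : ℤ_[p]) : IwasawaAlgebra p)) ⧸
      maximalIdeal (IwasawaAlgebra p) • (⊤ : Submodule (IwasawaAlgebra p)
        (Submodule.torsion' (IwasawaAlgebra p) M
          (Submonoid.powers (C (p : ℤ_[p]) : IwasawaAlgebra p))))) ≤ p ^ muInvariant p M := by
  haveI : IsNoetherian (IwasawaAlgebra p) M := isNoetherian_of_isNoetherianRing_of_finite _ M
  set Xt := Submodule.torsion' (IwasawaAlgebra p) M
    (Submonoid.powers (C (p : ℤ_[p]) : IwasawaAlgebra p)) with hXt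
  haveI : Module.Finite (IwasawaAlgebra p) Xt :=
    Module.Finite.of_injective Xt.subtype (Submodule.injective_subtype _)
  have hTt : Module.IsTorsion (IwasawaAlgebra p) Xt :=
    Literature.NumberTheory.EllipticCurves.isTorsion_of_injective Xt.subtype
      (Submodule.injective_subtype _) hM
  obtain ⟨g, hg0, hchar⟩ := exists_charGenerator_ne_zero Xt hTt
  have hlam : lam g = 0 := by
    rw [lam_generator_eq_lambdaInvariant Xt hTt hg0 hchar, hXt, lambdaInvariant_torsionP_eq_zero M]
  obtain ⟨hne, hval⟩ := valuation_constantCoeff_of_lam_eq_zero hg0 hlam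
  have h0 : constantCoeff g ≠ 0 := fun h ↦ hne (by rw [h, PadicInt.coe_zero])
  have hval' : (constantCoeff g).valuation = muInvariant p M := by
    rw [PadicInt.valuation_coe, mu_generator_eq_muInvariant Xt hTt hg0 hchar, hXt,
      muInvariant_torsionP_eq M hM] at hval
    exact_mod_cast hval
  obtain ⟨hfin, hle⟩ := GeneratorBound.natCard_quotient_maximalIdeal_le Xt hTt
    (torsionP_finite_eq_bot M hnf) g hchar h0
  exact ⟨hfin, hval' ▸ hle⟩

/-- **`#(X_f/𝔪X_f) ≤ p^{λ(X)}`** (and `X_f/𝔪X_f` is finite) for `X` finitely generated torsion: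
`X_f` is torsion with `μ = 0` and no nonzero finite submodule (§1), so `#(X_f/pX_f) = p^{λ(X_f)}`
(tree (L1) `Additive.card_quotient_eq_pow_lambdaInvariant_holds`), `𝔪 ⊇ (p)`, and `λ(X_f) = λ(X)`
(§2). [cite: Washington1997, §13.2 (after Thm. 13.12)] -/
theorem natCard_quotient_torsionP_quotient_maximalIdeal_le [Module.Finite (IwasawaAlgebra p) M]
    (hM : Module.IsTorsion (IwasawaAlgebra p) M) :
    Finite ((M ⧸ Submodule.torsion' (IwasawaAlgebra p) M
        (Submonoid.powers (C (p : ℤ_[p]) : IwasawaAlgebra p))) ⧸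
      maximalIdeal (IwasawaAlgebra p) • (⊤ : Submodule (IwasawaAlgebra p)
        (M ⧸ Submodule.torsion' (IwasawaAlgebra p) M
          (Submonoid.powers (C (p : ℤ_[p]) : IwasawaAlgebra p))))) ∧
    Nat.card ((M ⧸ Submodule.torsion' (IwasawaAlgebra p) M
        (Submonoid.powers (C (p : ℤ_[p]) : IwasawaAlgebra p))) ⧸
      maximalIdeal (IwasawaAlgebra p) • (⊤ : Submodule (IwasawaAlgebra p)
        (M ⧸ Submodule.torsion' (IwasawaAlgebra p) M
          (Submonoid.powers (C (p : ℤ_[p]) : IwasawaAlgebra p))))) ≤ p ^ lambdaInvariant p M := by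
  set Xt := Submodule.torsion' (IwasawaAlgebra p) M
    (Submonoid.powers (C (p : ℤ_[p]) : IwasawaAlgebra p)) with hXt
  have hTf : Module.IsTorsion (IwasawaAlgebra p) (M ⧸ Xt) :=
    Literature.NumberTheory.EllipticCurves.isTorsion_of_surjective Xt.mkQ
      (Submodule.mkQ_surjective _) hM
  have hcard : Nat.card ((M ⧸ Xt) ⧸ augIdealP p • (⊤ : Submodule (IwasawaAlgebra p) (M ⧸ Xt))) =
      p ^ lambdaInvariant p (M ⧸ Xt) :=
    Additive.card_quotient_eq_pow_lambdaInvariant_holds p (M ⧸ Xt) hTf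
      (muInvariant_quotient_torsionP_eq_zero M hM) (quotient_torsionP_finite_eq_bot M)
  haveI : Finite ((M ⧸ Xt) ⧸ augIdealP p • (⊤ : Submodule (IwasawaAlgebra p) (M ⧸ Xt))) :=
    Nat.finite_of_card_ne_zero (by rw [hcard]; exact pow_ne_zero _ hp.out.ne_zero)
  have hprime : (augIdealP p).IsPrime := isPrime_augIdealP_holds p
  have hle : augIdealP p • (⊤ : Submodule (IwasawaAlgebra p) (M ⧸ Xt)) ≤
      maximalIdeal (IwasawaAlgebra p) • (⊤ : Submodule (IwasawaAlgebra p) (M ⧸ Xt)) :=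
    Submodule.smul_mono_left (IsLocalRing.le_maximalIdeal hprime.ne_top)
  have hsurj := Submodule.factor_surjective hle
  refine ⟨Finite.of_surjective _ hsurj, ?_⟩
  rw [← lambdaInvariant_quotient_torsionP_eq M hM, ← hcard]
  exact Nat.card_le_card_of_surjective _ hsurj

/-! ## §4. Right exactness and GREENBERG'S INEQUALITY -/

omit hp in
/-- **Right exactness, counted**: for a submodule `N ≤ X` and an ideal `I` with `N/IN` finite,
`#(X/IX) ≤ #(N/IN) · #((X/N)/I(X/N))` — `Λ/I ⊗ −` is right exact (`lTensor_exact`) and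
`Λ/I ⊗ Y ≅ Y/IY` (`TensorProduct.quotTensorEquivQuotSMul`). (`Nat.card` of an infinite type is `0`;
the hypothesis makes the middle term finite whenever the right one is.) [folklore] -/
theorem natCard_quotient_smul_top_le_mul {R : Type*} [CommRing R] {X : Type*} [AddCommGroup X]
    [Module R X] (I : Ideal R) (N : Submodule R X)
    (hN : Finite (N ⧸ I • (⊤ : Submodule R N))) :
    Nat.card (X ⧸ I • (⊤ : Submodule R X)) ≤
      Nat.card (N ⧸ I • (⊤ : Submodule R N)) * Nat.card ((X ⧸ N) ⧸ I • (⊤ : Submodule R (X ⧸ N))) := by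
  -- transport to `R/I ⊗ −`
  rw [← Nat.card_congr (TensorProduct.quotTensorEquivQuotSMul X I).toEquiv,
    ← Nat.card_congr (TensorProduct.quotTensorEquivQuotSMul N I).toEquiv,
    ← Nat.card_congr (TensorProduct.quotTensorEquivQuotSMul (X ⧸ N) I).toEquiv]
  haveI : Finite ((R ⧸ I) ⊗[R] N) :=
    Finite.of_equiv _ (TensorProduct.quotTensorEquivQuotSMul N I).toEquiv.symm
  set f := LinearMap.lTensor (R ⧸ I) N.subtype with hf
  set g := LinearMap.lTensor (R ⧸ I) N.mkQ with hg
  have hexact : Function.Exact f g :=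
    lTensor_exact (R ⧸ I) (LinearMap.exact_subtype_mkQ N) (Submodule.mkQ_surjective N)
  have hsurj : Function.Surjective g := LinearMap.lTensor_surjective (R ⧸ I) (Submodule.mkQ_surjective N)
  have hker : LinearMap.ker g = LinearMap.range f := LinearMap.exact_iff.mp hexact
  rw [Submodule.card_eq_card_quotient_mul_card (LinearMap.ker g),
    Nat.card_congr (g.quotKerEquivOfSurjective hsurj).toEquiv, hker]
  exact Nat.mul_le_mul_right _ (Nat.card_le_card_of_surjective _ f.surjective_rangeRestrict)

/-- **GREENBERG'S INEQUALITY: `#(X/𝔪X) ≤ p^{λ(X) + μ(X)}`** — a finitely generated torsion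
`Λ = ℤ_p⟦T⟧`-module without nonzero finite `Λ`-submodules needs at most `λ + μ` generators
(`dim_{𝔽_p} X/𝔪X ≤ λ(X) + μ(X)`). Dévissage `0 → X[p^∞] → X → X_f → 0`: §4 right exactness,
§3 the two bounds. For `X = X(E/ℚ_∞)`, dual to `Sel_E(ℚ_∞)_p[𝔪] = Sel[p]^Γ`, this is the bound
route T's census uses at `μ ≥ 1` members (X1R0-GAPMAP §14.1); without the hypothesis it fails
(`X = Λ/𝔪`). [cite: GreenbergLNM1716, §1 p. 60, §4 Lemma 4.2, p. 137] [cite: Washington1997, §13.2] -/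
theorem natCard_quotient_maximalIdeal_le_pow_lambda_add_mu [Module.Finite (IwasawaAlgebra p) M]
    (hM : Module.IsTorsion (IwasawaAlgebra p) M)
    (hnf : ∀ N : Submodule (IwasawaAlgebra p) M, Finite N → N = ⊥) :
    Nat.card (M ⧸ maximalIdeal (IwasawaAlgebra p) • (⊤ : Submodule (IwasawaAlgebra p) M)) ≤
      p ^ (lambdaInvariant p M + muInvariant p M) := by
  obtain ⟨hfin_t, hle_t⟩ := natCard_torsionP_quotient_maximalIdeal_le M hM hnf
  obtain ⟨-, hle_f⟩ := natCard_quotient_torsionP_quotient_maximalIdeal_le M hM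
  calc _ ≤ _ := natCard_quotient_smul_top_le_mul (maximalIdeal (IwasawaAlgebra p)) _ hfin_t
    _ ≤ p ^ muInvariant p M * p ^ lambdaInvariant p M := Nat.mul_le_mul hle_t hle_f
    _ = p ^ (lambdaInvariant p M + muInvariant p M) := by rw [pow_add, mul_comm]

end Summit.BirchSwinnertonDyer.Rank1Residual.X1.GeneratorBoundMu

end
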